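import Mathlib
import HarnessLib
import Summits.ValiantsHypothesis.ValiantsHypothesis.Theorems.MonotoneRestorationOrbitRestorationQPEquivariantTermsTools
import Summits.ValiantsHypothesis.ValiantsHypothesis.Theorems.MonotoneRestorationOrbitRestorationQPCorePatternsAffine

/-!
# The SHAPE of a row/column-supported affine form: coefficient structure of local affine forms

Route MonotoneRestoration, crux `OrbitRestorationQP` (stmt-ValiantsHypothesis-18293), SPAN-currency lane of the open
sub-rung A_∞ (`stub_sigmaPiSigmaValue`); evidence note `SPAN-CURRENCY-A1-g7g4.md` §6 step (S1).  Helper (`--supports`),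
def-free.

`LocalFactors.exists_rowColSupports_of_matrixSymmetric` gives every factor `ℓ` of a matrix-symmetric affine product a row
support `R` and a column support `C`: the row permutations fixing `R` pointwise and the column permutations fixing `C`
pointwise fix `ℓ`.  This file turns that into the COEFFICIENT SHAPE used by the span-currency engine
(`CorePatterns.sum_placements_pow_affineLocalForm_mem_narrowSpan`, `…InjectivePlacementProducts.lean`):

* `coeff_eq_of_row_invariant`, `coeff_eq_of_col_invariant` — invariance transports coefficients along the permutation;
* **`coeff_shape_of_rowCol_invariant`** — there are `δ`, `α`, `β`, `γ` with, for every cell `P = (p, q)`,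
  `coeff_{x_P} ℓ = δ + [p ∈ R ∧ q ∈ C]·α P + [p ∈ R]·β p + [q ∈ C]·γ q`
  (so `ℓ = coeff₀ + δ U + Σ_{a∈R,b∈C} α x_{ab} + Σ_{a∈R} β_a R_a + Σ_{b∈C} γ_b C_b`);
* **`eq_localForm_of_rowCol_invariant`** — the same as an identity of polynomials:
  `ℓ = C β₀ + C δ · U + (Σ_{a∈R} Σ_{b∈C} C α_{ab} x_{ab} + Σ_{a∈R} C β_a R_a + Σ_{b∈C} C γ_b C_b)`.

Hypotheses are in `rename` form (`x_{(p,q)} ↦ x_{(ρ p, q)}`, resp. `x_{(p, ρ q)}`); no size condition on `R`, `C` is needed.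
Honest label: bookkeeping (S1); (S2)–(S3) of the note remain; no stub closed; VP ≠ VNP untouched.
-/

noncomputable section

-- `Summit.ValiantsHypothesis.ValiantsHypothesis.…` is the tree's single-conjunct layout (Sub = Summit).
set_option linter.dupNamespace false

namespace Summit.ValiantsHypothesis.ValiantsHypothesis.Theorems

namespace LocalFormShape

open MvPolynomial Finset Equiv

variable {n : ℕ}

/-- Row invariance transports the linear coefficients: `coeff x_{(ρ p, q)} ℓ = coeff x_{(p,q)} ℓ`. [folklore] -/
theorem coeff_eq_of_row_invariant (ℓ : MvPolynomial (Fin n × Fin n) ℂ) (ρ : Perm (Fin n))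
    (h : rename (fun P : Fin n × Fin n => (ρ P.1, P.2)) ℓ = ℓ) (p q : Fin n) :
    coeff (Finsupp.single (ρ p, q) 1) ℓ = coeff (Finsupp.single (p, q) 1) ℓ := by
  have hinj : Function.Injective (fun P : Fin n × Fin n => (ρ P.1, P.2)) := by
    intro P Q hPQ
    simp only [Prod.mk.injEq] at hPQ
    exact Prod.ext (ρ.injective hPQ.1) hPQ.2
  have := coeff_rename_mapDomain (fun P : Fin n × Fin n => (ρ P.1, P.2)) hinj ℓ (Finsupp.single (p, q) 1)
  rw [Finsupp.mapDomain_single, h] at this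
  exact this

/-- Column invariance transports the linear coefficients: `coeff x_{(p, ρ q)} ℓ = coeff x_{(p,q)} ℓ`. [folklore] -/
theorem coeff_eq_of_col_invariant (ℓ : MvPolynomial (Fin n × Fin n) ℂ) (ρ : Perm (Fin n))
    (h : rename (fun P : Fin n × Fin n => (P.1, ρ P.2)) ℓ = ℓ) (p q : Fin n) :
    coeff (Finsupp.single (p, ρ q) 1) ℓ = coeff (Finsupp.single (p, q) 1) ℓ := by
  have hinj : Function.Injective (fun P : Fin n × Fin n => (P.1, ρ P.2)) := by
    intro P Q hPQ
    simp only [Prod.mk.injEq] at hPQ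
    exact Prod.ext hPQ.1 (ρ.injective hPQ.2)
  have := coeff_rename_mapDomain (fun P : Fin n × Fin n => (P.1, ρ P.2)) hinj ℓ (Finsupp.single (p, q) 1)
  rw [Finsupp.mapDomain_single, h] at this
  exact this

/-- **Coefficient shape of a row/column-supported affine form.**  If the row permutations fixing `R` pointwise and the
column permutations fixing `C` pointwise fix `ℓ`, then for suitable `δ, α, β, γ` every linear coefficient is
`coeff x_{(p,q)} ℓ = δ + [p ∈ R ∧ q ∈ C] α (p,q) + [p ∈ R] β p + [q ∈ C] γ q`. [folklore] -/
theorem coeff_shape_of_rowCol_invariant (ℓ : MvPolynomial (Fin n × Fin n) ℂ) (R C : Finset (Fin n))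
    (hrow : ∀ ρ : Perm (Fin n), (∀ x ∈ R, ρ x = x) → rename (fun P : Fin n × Fin n => (ρ P.1, P.2)) ℓ = ℓ)
    (hcol : ∀ ρ : Perm (Fin n), (∀ x ∈ C, ρ x = x) → rename (fun P : Fin n × Fin n => (P.1, ρ P.2)) ℓ = ℓ) :
    ∃ (δ : ℂ) (α : Fin n × Fin n → ℂ) (β γ : Fin n → ℂ), ∀ P : Fin n × Fin n,
      coeff (Finsupp.single P 1) ℓ =
        δ + (if P.1 ∈ R ∧ P.2 ∈ C then α P else 0) + (if P.1 ∈ R then β P.1 else 0) +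
          (if P.2 ∈ C then γ P.2 else 0) := by
  classical
  set c : Fin n × Fin n → ℂ := fun P => coeff (Finsupp.single P 1) ℓ with hc
  -- constancy off the supports
  have hrowc : ∀ p p' q : Fin n, p ∉ R → p' ∉ R → c (p, q) = c (p', q) := by
    intro p p' q hp hp'
    have h := coeff_eq_of_row_invariant ℓ (swap p' p) (hrow _ fun x hx => by
      rw [swap_apply_of_ne_of_ne] <;> rintro rfl <;> contradiction) p' q
    simp only [swap_apply_left] at h
    simpa [hc] using h
  have hcolc : ∀ p q q' : Fin n, q ∉ C → q' ∉ C → c (p, q) = c (p, q') := by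
    intro p q q' hq hq'
    have h := coeff_eq_of_col_invariant ℓ (swap q' q) (hcol _ fun x hx => by
      rw [swap_apply_of_ne_of_ne] <;> rintro rfl <;> contradiction) p q'
    simp only [swap_apply_left] at h
    simpa [hc] using h
  -- base values
  set β : Fin n → ℂ := fun p => if h : ∃ q, q ∉ C then c (p, h.choose) else 0 with hβ
  set γ : Fin n → ℂ := fun q => if h : ∃ p, p ∉ R then c (h.choose, q) else 0 with hγ
  set δ : ℂ := if h : (∃ p, p ∉ R) ∧ (∃ q, q ∉ C) then c (h.1.choose, h.2.choose) else 0 with hδ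
  have hβv : ∀ p q, q ∉ C → c (p, q) = β p := by
    intro p q hq
    have hex : ∃ q, q ∉ C := ⟨q, hq⟩
    simp only [hβ, dif_pos hex]
    exact hcolc p q _ hq hex.choose_spec
  have hγv : ∀ p q, p ∉ R → c (p, q) = γ q := by
    intro p q hp
    have hex : ∃ p, p ∉ R := ⟨p, hp⟩
    simp only [hγ, dif_pos hex]
    exact hrowc p _ q hp hex.choose_spec
  have hδv : ∀ p q, p ∉ R → q ∉ C → c (p, q) = δ := by
    intro p q hp hq
    have hex : (∃ p, p ∉ R) ∧ (∃ q, q ∉ C) := ⟨⟨p, hp⟩, ⟨q, hq⟩⟩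
    simp only [hδ, dif_pos hex]
    rw [hrowc p hex.1.choose q hp hex.1.choose_spec, hcolc _ q _ hq hex.2.choose_spec]
  refine ⟨δ, fun P => c P - β P.1 - γ P.2 + δ, fun p => β p - δ, fun q => γ q - δ, fun P => ?_⟩
  obtain ⟨p, q⟩ := P
  show c (p, q) = _
  by_cases hp : p ∈ R <;> by_cases hq : q ∈ C
  · simp only [hp, hq, and_self, if_true]; ring
  · simp only [hp, hq, and_false, if_false, if_true]; rw [hβv p q hq]; ring
  · simp only [hp, hq, false_and, if_false, if_true]; rw [hγv p q hp]; ring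
  · simp only [hp, hq, and_self, if_false]; rw [hδv p q hp hq]; ring

/-- **The local affine form, as a polynomial identity.**  Under the same hypotheses (and `ℓ` affine),
`ℓ = C β₀ + C δ · U + (Σ_{a∈R} Σ_{b∈C} C α_{ab} x_{ab} + Σ_{a∈R} C β_a R_a + Σ_{b∈C} C γ_b C_b)`. [folklore] -/
theorem eq_localForm_of_rowCol_invariant (ℓ : MvPolynomial (Fin n × Fin n) ℂ) (hdeg : ℓ.totalDegree ≤ 1)
    (R C : Finset (Fin n))
    (hrow : ∀ ρ : Perm (Fin n), (∀ x ∈ R, ρ x = x) → rename (fun P : Fin n × Fin n => (ρ P.1, P.2)) ℓ = ℓ)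
    (hcol : ∀ ρ : Perm (Fin n), (∀ x ∈ C, ρ x = x) → rename (fun P : Fin n × Fin n => (P.1, ρ P.2)) ℓ = ℓ) :
    ∃ (β₀ δ : ℂ) (α : Fin n × Fin n → ℂ) (β γ : Fin n → ℂ),
      ℓ = MvPolynomial.C β₀ + MvPolynomial.C δ * (∑ i : Fin n, ∑ j : Fin n, (X (i, j) : MvPolynomial (Fin n × Fin n) ℂ)) +
        ((∑ a ∈ R, ∑ b ∈ C, MvPolynomial.C (α (a, b)) * (X (a, b) : MvPolynomial (Fin n × Fin n) ℂ)) +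
          (∑ a ∈ R, MvPolynomial.C (β a) * ∑ j : Fin n, (X (a, j) : MvPolynomial (Fin n × Fin n) ℂ)) +
          (∑ b ∈ C, MvPolynomial.C (γ b) * ∑ i : Fin n, (X (i, b) : MvPolynomial (Fin n × Fin n) ℂ))) := by
  classical
  obtain ⟨δ, α, β, γ, hcoef⟩ := coeff_shape_of_rowCol_invariant ℓ R C hrow hcol
  refine ⟨coeff 0 ℓ, δ, α, β, γ, ?_⟩
  have hℓ := eqvTerms_affine_eq ℓ hdeg
  -- the four pieces of the linear part
  have h1 : (∑ P : Fin n × Fin n, MvPolynomial.C δ * (X P : MvPolynomial (Fin n × Fin n) ℂ)) =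
      MvPolynomial.C δ * ∑ i : Fin n, ∑ j : Fin n, (X (i, j) : MvPolynomial (Fin n × Fin n) ℂ) := by
    rw [Finset.mul_sum, Fintype.sum_prod_type]
    simp_rw [Finset.mul_sum]
  have h2 : (∑ P : Fin n × Fin n, MvPolynomial.C (if P.1 ∈ R ∧ P.2 ∈ C then α P else 0) *
        (X P : MvPolynomial (Fin n × Fin n) ℂ)) =
      ∑ a ∈ R, ∑ b ∈ C, MvPolynomial.C (α (a, b)) * (X (a, b) : MvPolynomial (Fin n × Fin n) ℂ) := by
    rw [← Finset.sum_product (s := R) (t := C) (f := fun P : Fin n × Fin n =>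
      MvPolynomial.C (α P) * (X P : MvPolynomial (Fin n × Fin n) ℂ))]
    rw [← Finset.sum_filter_add_sum_filter_not (univ : Finset (Fin n × Fin n)) (fun P => P.1 ∈ R ∧ P.2 ∈ C)]
    have hset : (univ : Finset (Fin n × Fin n)).filter (fun P => P.1 ∈ R ∧ P.2 ∈ C) = R ×ˢ C := by
      ext P; simp
    rw [hset]
    have hzero : (∑ P ∈ (univ : Finset (Fin n × Fin n)).filter (fun P => ¬(P.1 ∈ R ∧ P.2 ∈ C)),
        MvPolynomial.C (if P.1 ∈ R ∧ P.2 ∈ C then α P else 0) * (X P : MvPolynomial (Fin n × Fin n) ℂ)) = 0 := by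
      refine Finset.sum_eq_zero fun P hP => ?_
      rw [if_neg (Finset.mem_filter.1 hP).2, map_zero, zero_mul]
    rw [hzero, add_zero]
    refine Finset.sum_congr rfl fun P hP => ?_
    rw [if_pos (by simpa [Finset.mem_product] using hP)]
  have h3 : (∑ P : Fin n × Fin n, MvPolynomial.C (if P.1 ∈ R then β P.1 else 0) *
        (X P : MvPolynomial (Fin n × Fin n) ℂ)) =
      ∑ a ∈ R, MvPolynomial.C (β a) * ∑ j : Fin n, (X (a, j) : MvPolynomial (Fin n × Fin n) ℂ) := by
    rw [Fintype.sum_prod_type]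
    simp_rw [Finset.mul_sum]
    rw [← Finset.sum_filter_add_sum_filter_not (univ : Finset (Fin n)) (fun a => a ∈ R)]
    have hset : (univ : Finset (Fin n)).filter (fun a => a ∈ R) = R := by ext a; simp
    rw [hset]
    have hzero : (∑ a ∈ (univ : Finset (Fin n)).filter (fun a => ¬ a ∈ R), ∑ j : Fin n,
        MvPolynomial.C (if a ∈ R then β a else 0) * (X (a, j) : MvPolynomial (Fin n × Fin n) ℂ)) = 0 := by
      refine Finset.sum_eq_zero fun a ha => ?_
      simp [(Finset.mem_filter.1 ha).2]
    rw [hzero, add_zero]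
    refine Finset.sum_congr rfl fun a ha => ?_
    simp [ha]
  have h4 : (∑ P : Fin n × Fin n, MvPolynomial.C (if P.2 ∈ C then γ P.2 else 0) *
        (X P : MvPolynomial (Fin n × Fin n) ℂ)) =
      ∑ b ∈ C, MvPolynomial.C (γ b) * ∑ i : Fin n, (X (i, b) : MvPolynomial (Fin n × Fin n) ℂ) := by
    rw [Fintype.sum_prod_type_right]
    simp_rw [Finset.mul_sum]
    rw [← Finset.sum_filter_add_sum_filter_not (univ : Finset (Fin n)) (fun b => b ∈ C)]
    have hset : (univ : Finset (Fin n)).filter (fun b => b ∈ C) = C := by ext b; simp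
    rw [hset]
    have hzero : (∑ b ∈ (univ : Finset (Fin n)).filter (fun b => ¬ b ∈ C), ∑ i : Fin n,
        MvPolynomial.C (if b ∈ C then γ b else 0) * (X (i, b) : MvPolynomial (Fin n × Fin n) ℂ)) = 0 := by
      refine Finset.sum_eq_zero fun b hb => ?_
      simp [(Finset.mem_filter.1 hb).2]
    rw [hzero, add_zero]
    refine Finset.sum_congr rfl fun b hb => ?_
    simp [hb]
  -- assemble
  conv_lhs => rw [hℓ]
  simp_rw [hcoef, map_add, add_mul, Finset.sum_add_distrib]
  rw [h1, h2, h3, h4]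
  ring

end LocalFormShape

end Summit.ValiantsHypothesis.ValiantsHypothesis.Theorems

end
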